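import Literature.Geometry.Lorentzian.KerrBoyerLindquistParametric
import Literature.Geometry.Lorentzian.KerrBoyerLindquistExtrinsicDecay
import Literature.Geometry.Lorentzian.DecaySymbolsAffine
import HarnessLib

/-!
# The Boyer–Lindquist rest template read in rotated and shifted axes

The quasi-isotropic Boyer–Lindquist template (`KerrBoyerLindquist*.lean`) is written with the spin
axis along `y₃` and the centre at the origin: chart coefficients `h_y = blHRepCLM M a y`,
`k_y = kRepCLM M a y`. A gluing construction meets it with an ARBITRARY spin axis and centre, i.e.
reads the template through a rigid motion `y ↦ g y + c` of the fixed chart of the end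
(`g : E3 ≃ₗᵢ[ℝ] E3`, `c : E3`): coefficients `y ↦ h_{g y + c}(g·, g·)`, `y ↦ k_{g y + c}(g·, g·)`.
This file records that nothing is lost:

* `Kerr.BL.isBigOSmooth_blHRepCLM_rigid_sub` — the moved metric is still
  `(1 + 2M/r) δ + O₂(r⁻²)` with the SAME mass parameter `M` (rotations fix `δ`, the shift of the
  origin costs `O₂(r⁻²)`: `IsBigOSmooth.massAspect_comp_rigid`);
* `Kerr.BL.isBigOSmooth_kRepCLM_rigid` — the moved extrinsic form is still `O₂(r⁻³)`;
* `Kerr.BL.isLittleO_drH_of_isBigOSmooth`, `Kerr.BL.isLittleO_drK_of_isBigOSmooth` and the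
  corollaries `isLittleO_blHRepCLM_rigid`, `isLittleO_kRepCLM_rigid` — the same in the little-`o`
  shape of the Dafermos–Rodnianski clauses (`o₂(r⁻¹)`, `o₁(r⁻²)`) used by the unit-scale gluing
  curve of the crux `TameEscapeToKerrEnds`;
* `Kerr.BL.contDiffAt_param_blHRepCLM_rigid`, `Kerr.BL.contDiffAt_param_kRepCLM_rigid` — the
  moved coefficients are jointly smooth in `(M, a, y)` (from `KerrBoyerLindquistParametric.lean`).

Everything is proved; no definitions, no named facts.

## References

* S. R. Brandt, E. Seidel, Phys. Rev. D 54 (1996) 1403, §II. [BrandtSeidel1996]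
* T. Regge, C. Teitelboim, Ann. Phys. 88 (1974) 286, §5 (frame independence of the asymptotic
  conditions).
-/

noncomputable section

open Set Filter Asymptotics Bornology Topology
open scoped ContDiff InnerProductSpace

namespace Literature.Geometry.Lorentzian

namespace Kerr.BL

open Kerr.Ingoing

variable {M a : ℝ}

/-! ### Decay of the moved template -/

/-- **The rotated and shifted Boyer–Lindquist metric template is `(1 + 2M/r)δ + O₂(r⁻²)` with the
same `M`.** [cite: BrandtSeidel1996, §II] -/
theorem isBigOSmooth_blHRepCLM_rigid_sub (M a : ℝ) (g : E3 ≃ₗᵢ[ℝ] E3) (c : E3) :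
    IsBigOSmooth 2 (-2) fun y : E3 ↦
      (blHRepCLM M a (g y + c)).bilinearComp (g : E3 →L[ℝ] E3) (g : E3 →L[ℝ] E3) -
        (1 + 2 * M / ‖y‖) • (innerSL ℝ : E3 →L[ℝ] E3 →L[ℝ] ℝ) := by
  have h : IsBigOSmooth 2 (-2) fun y : E3 ↦
      blHRepCLM M a y - (1 + 2 * M * ‖y‖⁻¹) • (innerSL ℝ : E3 →L[ℝ] E3 →L[ℝ] ℝ) :=
    (isBigOSmooth_blHRepCLM_sub M a).congr fun y ↦ by rw [div_eq_mul_inv]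
  exact (h.massAspect_comp_rigid g c).congr fun y ↦ by rw [div_eq_mul_inv]

/-- **The rotated and shifted Boyer–Lindquist extrinsic template is `O₂(r⁻³)`** (`0 ≤ M`).
[cite: BrandtSeidel1996, §II] -/
theorem isBigOSmooth_kRepCLM_rigid (hM : 0 ≤ M) (a : ℝ) (g : E3 ≃ₗᵢ[ℝ] E3) (c : E3) :
    IsBigOSmooth 2 (-3) fun y : E3 ↦
      (kRepCLM M a (g y + c)).bilinearComp (g : E3 →L[ℝ] E3) (g : E3 →L[ℝ] E3) :=
  (isBigOSmooth_kRepCLM hM a).bilinForm_comp_rigid g c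

/-! ### The little-`o` shape of the Dafermos–Rodnianski clauses -/

/-- An `O₂(r⁻²)` chart tensor is `o₂(r⁻¹)`: `‖∂^m F‖ = o(r^{-1-m})`, `m ≤ 2` (the metric clause of
the Dafermos–Rodnianski class). [folklore] -/
theorem isLittleO_drH_of_isBigOSmooth {W : Type*} [NormedAddCommGroup W] [NormedSpace ℝ W]
    {F : E3 → W} (hF : IsBigOSmooth 2 (-2) F) {m : ℕ} (hm : m ≤ 2) :
    (fun y : E3 ↦ ‖iteratedFDeriv ℝ m F y‖) =o[cobounded E3] fun y ↦ ‖y‖ ^ (-1 - m : ℝ) :=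
  (hF.isBigO hm).trans_isLittleO (isLittleO_norm_rpow_rpow_cobounded (E := E3) (by linarith))

/-- An `O₁(r⁻³)` chart tensor is `o₁(r⁻²)`: `‖∂^m K‖ = o(r^{-2-m})`, `m ≤ 1` (the `k` clause of the
Dafermos–Rodnianski class). [folklore] -/
theorem isLittleO_drK_of_isBigOSmooth {W : Type*} [NormedAddCommGroup W] [NormedSpace ℝ W]
    {K : E3 → W} (hK : IsBigOSmooth 1 (-3) K) {m : ℕ} (hm : m ≤ 1) :
    (fun y : E3 ↦ ‖iteratedFDeriv ℝ m K y‖) =o[cobounded E3] fun y ↦ ‖y‖ ^ (-2 - m : ℝ) :=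
  (hK.isBigO hm).trans_isLittleO (isLittleO_norm_rpow_rpow_cobounded (E := E3) (by linarith))

/-- **The moved metric template satisfies the Dafermos–Rodnianski metric clause with mass `M`.**
[cite: BrandtSeidel1996, §II] -/
theorem isLittleO_blHRepCLM_rigid (M a : ℝ) (g : E3 ≃ₗᵢ[ℝ] E3) (c : E3) {m : ℕ} (hm : m ≤ 2) :
    (fun y : E3 ↦ ‖iteratedFDeriv ℝ m (fun y : E3 ↦
        (blHRepCLM M a (g y + c)).bilinearComp (g : E3 →L[ℝ] E3) (g : E3 →L[ℝ] E3) -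
          (1 + 2 * M / ‖y‖) • (innerSL ℝ : E3 →L[ℝ] E3 →L[ℝ] ℝ)) y‖)
      =o[cobounded E3] fun y ↦ ‖y‖ ^ (-1 - m : ℝ) :=
  isLittleO_drH_of_isBigOSmooth (isBigOSmooth_blHRepCLM_rigid_sub M a g c) hm

/-- **The moved extrinsic template satisfies the Dafermos–Rodnianski `k` clause** (`0 ≤ M`).
[cite: BrandtSeidel1996, §II] -/
theorem isLittleO_kRepCLM_rigid (hM : 0 ≤ M) (a : ℝ) (g : E3 ≃ₗᵢ[ℝ] E3) (c : E3) {m : ℕ}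
    (hm : m ≤ 1) :
    (fun y : E3 ↦ ‖iteratedFDeriv ℝ m (fun y : E3 ↦
        (kRepCLM M a (g y + c)).bilinearComp (g : E3 →L[ℝ] E3) (g : E3 →L[ℝ] E3)) y‖)
      =o[cobounded E3] fun y ↦ ‖y‖ ^ (-2 - m : ℝ) :=
  isLittleO_drK_of_isBigOSmooth ((isBigOSmooth_kRepCLM_rigid hM a g c).of_le one_le_two) hm

/-! ### Joint smoothness of the moved template in `(M, a, y)` -/

/-- Conjugating a `C^n` family of bilinear forms by fixed linear maps keeps it `C^n`:
`q ↦ B(q)(g₁·, g₂·)` (`bilinearComp = flip ∘ comp ∘ flip ∘ comp`, each step smooth). [folklore] -/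
theorem contDiffAt_bilinearComp_const {P : Type*} [NormedAddCommGroup P] [NormedSpace ℝ P]
    {B : P → E3 →L[ℝ] E3 →L[ℝ] ℝ} {q : P} {n : WithTop ℕ∞} (hB : ContDiffAt ℝ n B q)
    (g₁ g₂ : E3 →L[ℝ] E3) :
    ContDiffAt ℝ n (fun q ↦ (B q).bilinearComp g₁ g₂) q := by
  have hF : ContDiff ℝ n (ContinuousLinearMap.flipₗᵢ ℝ E3 E3 ℝ) :=
    LinearIsometryEquiv.contDiff (𝕜 := ℝ) (E := E3 →L[ℝ] E3 →L[ℝ] ℝ) (F := E3 →L[ℝ] E3 →L[ℝ] ℝ)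
      (ContinuousLinearMap.flipₗᵢ ℝ E3 E3 ℝ)
  have h1 : ContDiffAt ℝ n (fun q ↦ (B q).comp g₁) q := hB.clm_comp contDiffAt_const
  have h2 := hF.contDiffAt.comp q h1
  have h2' : ContDiffAt ℝ n (fun q ↦ ((B q).comp g₁).flip) q := h2
  have h3 : ContDiffAt ℝ n (fun q ↦ ((B q).comp g₁).flip.comp g₂) q := h2'.clm_comp contDiffAt_const
  have h4 := hF.contDiffAt.comp q h3
  have h4' : ContDiffAt ℝ n (fun q ↦ (((B q).comp g₁).flip.comp g₂).flip) q := h4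
  exact h4'

variable {p : ℝ × ℝ × E3}

/-- `p ↦ g y + c` is smooth on the parameter space. [folklore] -/
theorem contDiffAt_param_rigid (g : E3 ≃ₗᵢ[ℝ] E3) (c : E3) {n : WithTop ℕ∞} :
    ContDiffAt ℝ n (fun p : ℝ × ℝ × E3 ↦ g p.2.2 + c) p :=
  (((g : E3 →L[ℝ] E3).contDiff.contDiffAt).comp p contDiffAt_param_snd_snd).add contDiffAt_const

/-- **The moved metric template is jointly smooth in `(M, a, y)`** at every `(M, a, y)` with
`0 ≤ M`, `ρH(M, a) < ‖g y + c‖`. [cite: BrandtSeidel1996, §II] -/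
theorem contDiffAt_param_blHRepCLM_rigid (g : E3 ≃ₗᵢ[ℝ] E3) (c : E3) (h0 : 0 ≤ p.1)
    (hρ : rhoH p.1 p.2.1 < ‖g p.2.2 + c‖) :
    ContDiffAt ℝ ∞ (fun p : ℝ × ℝ × E3 ↦
      (blHRepCLM p.1 p.2.1 (g p.2.2 + c)).bilinearComp (g : E3 →L[ℝ] E3) (g : E3 →L[ℝ] E3)) p :=
  contDiffAt_bilinearComp_const (contDiffAt_blHRepCLM_comp (q := p) contDiffAt_param_fst
    contDiffAt_param_snd_fst (contDiffAt_param_rigid g c) h0 hρ) _ _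

/-- **The moved extrinsic template is jointly smooth in `(M, a, y)`** at every `(M, a, y)` with
`0 ≤ M`, `ρH(M, a) < ‖g y + c‖`. [cite: BrandtSeidel1996, §II] -/
theorem contDiffAt_param_kRepCLM_rigid (g : E3 ≃ₗᵢ[ℝ] E3) (c : E3) (h0 : 0 ≤ p.1)
    (hρ : rhoH p.1 p.2.1 < ‖g p.2.2 + c‖) :
    ContDiffAt ℝ ∞ (fun p : ℝ × ℝ × E3 ↦
      (kRepCLM p.1 p.2.1 (g p.2.2 + c)).bilinearComp (g : E3 →L[ℝ] E3) (g : E3 →L[ℝ] E3)) p :=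
  contDiffAt_bilinearComp_const (contDiffAt_kRepCLM_comp (q := p) contDiffAt_param_fst
    contDiffAt_param_snd_fst (contDiffAt_param_rigid g c) h0 hρ) _ _

end Kerr.BL

end Literature.Geometry.Lorentzian

end
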